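import Summits.NavierStokesRegularity.NavierStokesRegularity.Theorems.SoloSalvageWu2026Energy
import Summits.NavierStokesRegularity.NavierStokesRegularity.Theorems.SoloSalvageWu2026Reduced2
import Summits.NavierStokesRegularity.NavierStokesRegularity.Theorems.SoloSalvageWu2026Step382
import Literature.Analysis.FluidPDE.BiotSavartRepresentationDecay
import HarnessLib

/-!
# C177 `Wu2026` — TRUE column: `Step_L21` (Lemma 2.1: endpoint Biot–Savart, `v ∈ L^{9/2,∞}` and
# `D(v) < ∞`) HOLDS; Theorem 1.1 reduced to the FOUR remaining printed steps
# (D-0090 NS-CLAIMS, LADDER row rung 3; seat `ns-claims-lit-1 g11`, filed in the salvage namespace)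

The first consumed binder of `Literature.Claims.NS.Wu2026.claim_of_steps''`, `Step_L21` = Lemma 2.1
p.5 l.30–52 («If ω ∈ L^{9/5,∞}(R³), then v(x) = (1/4π)∫ ω(y) × (x − y)/|x − y|³ dy (2.2) …
‖v‖_{L^{9/2,∞}(R³)} ≤ C‖ω‖_{L^{9/5,∞}(R³)} (2.3) and D(v) ≤ C‖ω‖³ (2.4)»), was split by
`SoloSalvageWu2026Energy.lean` (salvage-p3 g6) into its weak-HLS half (2.3) and its Seregin–Wang half
(2.4), the latter PROVED there (`dirichlet_lt_top_of_memWeakLp`, `step_L21_of_weakHLS`). The weak-HLS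
half is now the Literature theorem `Literature.Analysis.FluidPDE.memWeakLp_nine_halves_of_memWeakLp_curl`
(`BiotSavartRepresentationDecay.lean`: Biot–Savart representation for `C²` divergence-free fields
vanishing at infinity via the tree's local Helmholtz identity at scale `ρ → ∞`, pointwise majorant
`|v| ≤ (4π)⁻¹ I₁|curl v|`, and the weak-type Hardy–Littlewood–Sobolev inequality
`meas_lt_rieszPotential_le_of_eWeakLpPow`, salvage-p4 g6). Hence:

* `memWeakLp_nine_halves_of_isWuFlow` — (2.3) for every `IsWuFlow`;
* `dirichlet_lt_top_of_isWuFlow` — (2.4) for every `IsWuFlow` (no extra hypothesis);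
* `step_L21` — **`Step_L21` holds exactly as typed**;
* `claimedTheorem_of_four_open_steps` / `wu2026_thm11_of_four_open_steps` — the skeleton's Theorem 1.1
  (`ClaimedTheorem := Literature.Analysis.FluidPDE.Wu2026_thm11`) from the FOUR printed steps not yet
  ported: §3.3 canonical pressure (`Step_341`), §3.2–§3.4 tangent construction (`Step_construct`),
  Prop 3.3 (`Step_P33`), (3.83)–(3.85) (`Step_385`) — the binders `Step_L21` (this file), `Step_33`,
  `Step_P34`, `Step_382` (`SoloSalvageWu2026DivCurl` / `…RadialFlux` / `…Step382`, via
  `claimedTheorem_of_six_open_steps` of `SoloSalvageWu2026Reduced2`), `Step_38`, `Step_318`,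
  `Step_386`, `Step_387`, `Step_L31`, `Step_D0` being kernel theorems. Nothing here asserts any of the
  four.

Records, not a verdict: the row is ADJUDICATED #164 («discharges», professional register; chair
lead-1 g7 19:44:44Z); this is a TRUE-column kernel object (TAKING ns-claims-lit-1 g11 20:45:41Z,
DECONFLICT with salvage-p4 g6 / salvage-p3). Standard axioms; no definition, no named fact.

WHAT THIS IS NOT: not a claim about NS regularity or blow-up; not a claim about any author beyond the
typed locator.
-/

noncomputable section

set_option linter.dupNamespace false

open MeasureTheory Set Function Filter Topology Metric
open scoped ENNReal NNReal RealInnerProductSpace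

namespace Summit.NavierStokesRegularity.NavierStokesRegularity.Theorems.Wu2026Salvage

open Literature.Claims.NS.Wu2026 Literature.Analysis.FluidPDE Literature.Analysis.FunctionSpaces

/-- **Lemma 2.1 (2.3) for the class**: every `IsWuFlow ν v p` (smooth steady flow, `v → 0` at
infinity, `curl v ∈ L^{9/5,∞}`) has `v ∈ L^{9/2,∞}(ℝ³)` — by the Literature theorem
`memWeakLp_nine_halves_of_memWeakLp_curl` (fields `profile.contDiff_velocity`, `profile.divFree`,
`decay`, `weakVort`; the equation is not used). [cite: Wu2026, Lemma 2.1 (2.3) p.5 l.44–46] -/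
theorem memWeakLp_nine_halves_of_isWuFlow {ν : ℝ} {v : E3 → E3} {p : E3 → ℝ}
    (hf : IsWuFlow ν v p) : MemWeakLp v ((9 : ℝ≥0∞) / 2) volume :=
  memWeakLp_nine_halves_of_memWeakLp_curl hf.profile.contDiff_velocity hf.profile.divFree hf.decay
    hf.weakVort

/-- **Lemma 2.1 (2.2) for the class, pointwise majorant form**: for every `IsWuFlow` and every `x`,
`‖v(x)‖ ≤ (4π)⁻¹ I₁(‖curl v‖)(x)` in `[0, ∞]`. [cite: Wu2026, Lemma 2.1 (2.2)/(2.8) p.5 l.37–40, p.6 l.40–48] -/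
theorem enorm_le_rieszPotential_curl_of_isWuFlow {ν : ℝ} {v : E3 → E3} {p : E3 → ℝ}
    (hf : IsWuFlow ν v p) (x : E3) :
    ‖v x‖ₑ ≤ ENNReal.ofReal (4 * Real.pi)⁻¹ *
      Literature.Analysis.SingularIntegrals.rieszPotential volume 1 (fun y => ‖curl v y‖ₑ) x :=
  enorm_le_rieszPotential_curl hf.profile.contDiff_velocity hf.profile.divFree hf.decay x

/-- **Lemma 2.1 (2.4) for the class**: every `IsWuFlow ν v p`, `ν > 0`, has finite Dirichlet energy
`D(v) < ∞` — (2.3) fed into the Seregin–Wang half `dirichlet_lt_top_of_memWeakLp`.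
[cite: Wu2026, Lemma 2.1 (2.4) p.5 l.50–52] -/
theorem dirichlet_lt_top_of_isWuFlow {ν : ℝ} (hν : 0 < ν) {v : E3 → E3} {p : E3 → ℝ}
    (hf : IsWuFlow ν v p) : dirichlet v < ⊤ :=
  dirichlet_lt_top_of_memWeakLp hν hf (memWeakLp_nine_halves_of_isWuFlow hf)

/-- **`Step_L21` holds** (Lemma 2.1 p.5 l.30–52, both consumed conclusions: `v ∈ L^{9/2,∞}` and
`D(v) < ∞` for every `IsWuFlow`), via `step_L21_of_weakHLS`. [cite: Wu2026, Lemma 2.1 p.5 l.30–52] -/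
theorem step_L21 : Step_L21 :=
  step_L21_of_weakHLS fun _ν _hν _v _p hf => memWeakLp_nine_halves_of_isWuFlow hf

/-- **Theorem 1.1 of arXiv:2608.22471v1 from the four steps not yet ported** (§3.3 canonical pressure,
§3.2–§3.4 tangent construction, Prop 3.3, (3.83)–(3.85)); Lemma 2.1, (3.3), (3.4)–(3.8), Lemma 3.1,
(3.18), Prop 3.4, (3.72)–(3.82), (3.86), (3.87) and the `D = 0` case are kernel theorems.
[cite: Wu2026, Thm 1.1 p.2 l.30–37; proof §3 p.7–26] -/
theorem claimedTheorem_of_four_open_steps (h341 : Step_341) (hcon : Step_construct)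
    (hP33 : Step_P33) (h385 : Step_385) : ClaimedTheorem :=
  claimedTheorem_of_six_open_steps step_L21 h341 hcon hP33 step_382 h385

/-- The same for the tree's named fact `Wu2026_thm11`. [cite: Wu2026, Thm 1.1 p.2 l.30–37] -/
theorem wu2026_thm11_of_four_open_steps (h341 : Step_341) (hcon : Step_construct)
    (hP33 : Step_P33) (h385 : Step_385) : Literature.Analysis.FluidPDE.Wu2026_thm11 :=
  claimedTheorem_of_four_open_steps h341 hcon hP33 h385

/-- And for Corollary 1.2, via the tree's PROVED `Wu2026_cor12_of_thm11`. [cite: Wu2026, Cor 1.2 p.2 l.42–56] -/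
theorem wu2026_cor12_of_four_open_steps (h341 : Step_341) (hcon : Step_construct)
    (hP33 : Step_P33) (h385 : Step_385) : Literature.Analysis.FluidPDE.Wu2026_cor12 :=
  claimedCor_of_claimedTheorem (claimedTheorem_of_four_open_steps h341 hcon hP33 h385)

end Summit.NavierStokesRegularity.NavierStokesRegularity.Theorems.Wu2026Salvage

end

-- WHAT THIS IS NOT: not a claim about NS regularity or blow-up; not a claim about any author beyond the typed locator.
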